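import Summits.ResolutionOfSingularities.ResolutionOfSingularities.Theorems.WeightedInvariantELadderTwoTrivialEndModel
import Summits.ResolutionOfSingularities.ResolutionOfSingularities.Theorems.WeightedInvariantELadderTwoCompatible
import Summits.ResolutionOfSingularities.ResolutionOfSingularities.Theorems.WeightedInvariantELadderOneSingOffCentre
import Summits.ResolutionOfSingularities.ResolutionOfSingularities.Theorems.WeightedInvariantELadderOneSingOverSupport
import Literature.AlgebraicGeometry.Resolution.SmoothStalksRegular
import Literature.AlgebraicGeometry.Resolution.RegularLocalRingsProofs
import HarnessLib

/-!
# E2 tier, (S-a): THE OFF-SUPPORT LOCAL MODEL OF `B₊` — `Stage.SuccOffCentreAt` off the support of the centre; `E2StepOffBody p`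

Route `ResolutionOfSingularities/WeightedInvariant`, crux `Theses.WeightedInvariant.HypersurfaceCentreConstruction`
(stmt-ResolutionOfSingularities-19897), door line `local-engine`, E2 tier; piece (S-a) of the registered stub `stub_e2_step_h`
(res-L1-w43-plan-1 SPEC (Δ6)/(Δ6b) `HOME/L/res-L1-w43-plan-1/E2Step_split_sketch.lean` rev 3 3dbfad7a331aa48b, OFFER (o59-a),
input `ha` of the registrar's glue `stub_e2_step_h_of_four'`).

* `ELadderOne.succOffCentreAt_of_not_mem_support` — for a stage `S`, an admissible centre `R` with Rees filtration `R'`, ANY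
  presentation data `(V', ρ, q', 𝒜')` of the successor over `B₊ = R'.plus` and a point `η'` with `y = σ₊ η' ∉ supp R`:
  `S.SuccOffCentreAt S' σ₊ η'` — `𝒪_{B₊,η'}` is the localisation of `𝒪_{Y,y}[X]` at a prime over `𝔪_y`, compatibly with `σ₊^♯`,
  and the local equation of the strict transform at `η'` is associated to the image of the local equation of `X` at `y`.
  Route = the chart route of the e = 1 off-centre file (`ELadderOne.piPlus_mem_singImage_of_not_mem_support`, res-D-pv-023 /
  type-o7): an affine `W ∋ y` on which every piece of `R` is the unit ideal, so `⊕ 𝒥ₙ(W) tⁿ` is the whole Laurent ring and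
  `t⁻¹`, `tⁿ` are units; the chart `D(tⁿ) ∋ η'` of `B₊` with coordinate ring `⊕ 𝒥ₙ(W) tⁿ` (`AtlasAmbient.exists_chart`); the stalk
  of `B₊` at `η'` is the localisation of `⊕ 𝒥ₙ(W) tⁿ` at a prime `Q ∌ t⁻¹`; the ring-level model
  `TrivialEnd.exists_offCentre_polynomial_model` (…ELadderTwoTrivialEndModel); the strict transform on the chart is the extension
  of `X(W)` (trivial `t⁻¹`-saturation), whence the `Associated` clause in the domain `𝒪_{B₊,η'}` (`B₊` smooth over `k`).
* **`LocalEngine.e2StepOffBody (p) : <the body of E2StepOffBody p>`** — the registrar's statement binder for binder (atlas-free,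
  `ι`/`J`-free; `p`, `CharP`, `PerfectField` unused: the off-support model is characteristic-free).
Def-free; OURS bookkeeping; nothing here is a claim about Hironaka's problem; AI-written, weaker than expert review.
[cite: Wlodarczyk2022, Def. 2.3.5 and 3.3.12]
-/

noncomputable section

set_option linter.dupNamespace false -- mandated namespace of this single-conjunct summit

open scoped LaurentPolynomial
open LaurentPolynomial IsLocalRing
open Literature.AlgebraicGeometry.Resolution

/-! ## Scheme level: the torus-factor model at a point of `B₊` off the support of the centre -/

namespace Summit.ResolutionOfSingularities.ResolutionOfSingularities.Theorems.ELadderOne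

open CategoryTheory AlgebraicGeometry TopologicalSpace
open Summit.ResolutionOfSingularities.ResolutionOfSingularities.Theorems.DatumToEmbedded.AtlasAmbient
open Summit.ResolutionOfSingularities.ResolutionOfSingularities.Cruxes.HypersurfaceCentreConstruction.LocalEngine

-- `Γ(B₊, W')` versus `presheaf.obj` inside `rw` motives and instance problems on the glued scheme
-- `R'.cobordantBlowup` / `R'.plus` (as in `…ELadderOneSingOffCentre`):
set_option backward.isDefEq.respectTransparency false

/-- The germ of `f.appLE U V e a` at `x ∈ V` is the germ of `a` at `f x` pushed along `f^♯_x`. [folklore] -/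
theorem germ_appLE_apply {X Y : Scheme.{0}} (f : X ⟶ Y) (U : Y.Opens) (V : X.Opens) (e : V ≤ f ⁻¹ᵁ U)
    (x : X) (hx : x ∈ V) (a : Γ(Y, U)) :
    X.presheaf.germ V x hx (f.appLE U V e a) = f.stalkMap x (Y.presheaf.germ U (f x) (e hx) a) := by
  rw [Scheme.Hom.germ_stalkMap_apply]
  simp only [Scheme.Hom.appLE, CommRingCat.hom_comp, RingHom.coe_comp, Function.comp_apply,
    TopCat.Presheaf.germ_res_apply']

variable {k : Type} [Field k]

/-- **(S-a) THE OFF-SUPPORT LOCAL MODEL OF `B₊` — `Stage.SuccOffCentreAt` at every point of `R'.plus` off the support of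
the centre** (res-L1-w43-plan-1 SPEC (Δ6) `E2StepOffBody`, atlas-free, `ι`/`J`-free).  For a stage `S`, an admissible centre
`R` with Rees filtration `R'`, ANY presentation data `(V', ρ, q', 𝒜')` of the successor over `B₊ = R'.plus` and a point `η'`
with `y = σ₊ η' ∉ supp R`: `𝒪_{B₊,η'}` is the localisation of `𝒪_{Y,y}[X]` at a prime `𝔮` over `𝔪_y`, compatibly with
`σ₊^♯_{η'}`, and the local equation of the strict transform at `η'` is (associated to) the image of the local equation of
`X` at `y`.  Route (the e = 1 chart route of `piPlus_mem_singImage_of_not_mem_support`): an affine `W ∋ y` on which every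
piece of `R` is the unit ideal (`ideal_eq_top_of_forall_not_mem_support`, `ideal_eq_top_of_pos`), so `⊕ 𝒥ₙ(W) tⁿ` is the
whole Laurent ring and `t`, `t⁻¹` are units; the chart `D(tⁿ) ∋ η'` of `B₊` with coordinate ring `⊕ 𝒥ₙ(W) tⁿ`
(`AtlasAmbient.exists_chart`); the stalk of `B₊` at `η'` is the localisation of `⊕ 𝒥ₙ(W) tⁿ` at a prime `Q ∌ t⁻¹`; the
ring-level model `TrivialEnd.exists_offCentre_polynomial_model`; the strict transform on the chart is the extension of
`X(W)` (the `t⁻¹`-saturation is trivial), whence the `Associated` clause in the domain `𝒪_{B₊,η'}` (smooth over `k`).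
[cite: Wlodarczyk2022, Def. 2.3.5 and 3.3.12] -/
theorem succOffCentreAt_of_not_mem_support (S : Stage k) (R : ReesAlgebraData S.Y)
    (hadm : IsAdmissibleCentre S.f S.i.ker R) (R' : ReesFiltration S.Y) (hR' : R'.ideal = R.piece)
    [Smooth (R'.πPlus ≫ S.f)] [IsSeparated (R'.πPlus ≫ S.f)] [QuasiCompact (R'.πPlus ≫ S.f)]
    [IsIntegral (R'.strictTransformPlus S.i.ker).subscheme]
    (hlp' : IsLocallyPrincipal (R'.strictTransformPlus S.i.ker).subschemeι.ker)
    (V' : Scheme.{0}) (ρ : V' ⟶ S.V) [IsIntegral V'] [IsProper ρ]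
    (q' : (R'.strictTransformPlus S.i.ker).subscheme ⟶ V')
    (hq' : q' ≫ ρ ≫ S.g = (R'.strictTransformPlus S.i.ker).subschemeι ≫ R'.πPlus ≫ S.f)
    (𝒜' : GradedAtlas (S.j + 1) (R'.πPlus ≫ S.f) (R'.strictTransformPlus S.i.ker).subschemeι q')
    (η' : (R'.plus : Scheme.{0})) (hys : R'.πPlus.base η' ∉ R.support) :
    S.SuccOffCentreAt ⟨R'.plus, R'.πPlus ≫ S.f, (R'.strictTransformPlus S.i.ker).subscheme,
        (R'.strictTransformPlus S.i.ker).subschemeι, hlp', V', q', ρ ≫ S.g, hq', S.j + 1, 𝒜'⟩ R'.πPlus η' := by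
  classical
  haveI : IsLocallyNoetherian S.Y := LocallyOfFiniteType.isLocallyNoetherian S.f
  haveI : IsLocallyNoetherian R'.cobordantBlowup := S.isLocallyNoetherian_cobordantBlowup R hadm.1 R' hR'
  -- (1) an affine `W ∋ σ₊ η'` on which all pieces are the unit ideal
  obtain ⟨n, hn, hyn⟩ : ∃ n : ℕ, 0 < n ∧ R'.πPlus η' ∉ (R.piece n).support := by
    by_contra h
    push Not at h
    exact hys (R.mem_support_iff.mpr h)
  obtain ⟨_, ⟨W₁, hWaff, rfl⟩, hyW, hWle⟩ := S.Y.isBasis_affineOpens.exists_subset_of_mem_open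
    (show R'.πPlus η' ∈ ((R.piece n).support : Set S.Y)ᶜ from hyn) (R.piece n).support.isClosed.isOpen_compl
  obtain ⟨W, hWW₁⟩ : ∃ W : S.Y.affineOpens, (W : S.Y.Opens) = W₁ := ⟨⟨W₁, hWaff⟩, rfl⟩
  have hyW' : R'.πPlus η' ∈ (W : S.Y.Opens) := hWW₁ ▸ hyW
  have hWle' : ((W : S.Y.Opens) : Set S.Y) ⊆ ((R.piece n).support : Set S.Y)ᶜ := hWW₁ ▸ hWle
  have hWn : (R'.ideal n).ideal W = ⊤ := by
    rw [hR']
    exact ideal_eq_top_of_forall_not_mem_support (R.piece n) W fun y hy hmem => hWle' hy hmem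
  have hall : ∀ m, (R'.ideal m).ideal W = ⊤ := StrictTransformDimension.ideal_eq_top_of_pos R' W hn hWn
  -- (2) the sections ring over `W` is the whole Laurent ring; `t⁻¹` and `tⁿ` are units
  haveI : IsNoetherianRing Γ(S.Y, W) := IsLocallyNoetherian.component_noetherian W
  have hS : ∀ p : (Γ(S.Y, W))[T;T⁻¹], p ∈ R'.sectionsRing W := fun p => by
    rw [IdealFiltration.mem_extendedRees_iff]
    intro m
    rw [ReesFiltration.filtration_ideal, hall m]
    trivial
  let t : R'.sectionsRing W := ⟨T (-1), (R'.filtration W).T_neg_one_mem_extendedRees⟩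
  have ht : ((t : (R'.sectionsRing W)) : (Γ(S.Y, W))[T;T⁻¹]) = T (-1) := rfl
  have htu : IsUnit t := by
    refine isUnit_iff_exists_inv.mpr ⟨⟨T 1, hS _⟩, Subtype.ext ?_⟩
    show (T (-1) * T 1 : (Γ(S.Y, W))[T;T⁻¹]) = 1
    rw [← T_add, neg_add_cancel, T_zero]
  let v₀ : R'.sectionsRing W := ⟨T (n : ℤ), hS _⟩
  have hv₀irr : v₀ ∈ (R'.filtration W).irrelevant := by
    refine Ideal.subset_span ⟨n, 1, hn, ?_, ?_⟩
    · rw [ReesFiltration.filtration_ideal, hWn]; trivial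
    · show (T (n : ℤ) : (Γ(S.Y, W))[T;T⁻¹]) = LaurentPolynomial.C 1 * T (n : ℤ)
      rw [map_one, one_mul]
  have hv₀u : IsUnit v₀ := by
    refine isUnit_iff_exists_inv.mpr ⟨⟨T (-(n : ℤ)), hS _⟩, Subtype.ext ?_⟩
    show (T (n : ℤ) * T (-(n : ℤ)) : (Γ(S.Y, W))[T;T⁻¹]) = 1
    rw [← T_add, add_neg_cancel, T_zero]
  haveI : IsLocalization.Away v₀ (R'.sectionsRing W) :=
    IsLocalization.away_of_isUnit_of_bijective _ hv₀u Function.bijective_id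
  -- (3) the chart `D(v₀) ∋ η'` of `B₊`, with coordinate ring `⊕ 𝒥ₙ(W) tⁿ` itself
  obtain ⟨W', hW', e, he₁, he₂, he₃, he₄⟩ := exists_chart R' W (R'.sectionsRing W) v₀ hv₀irr
  obtain ⟨q₀, -, hq₀⟩ := DatumToEmbedded.Exceptional.exists_mem_plusChart R' η'.1 η'.2 W hyW'
  have hη'W' : η' ∈ (W' : (R'.plus : Scheme.{0}).Opens) :=
    he₄ η' q₀ hq₀ fun h => q₀.2.ne_top (Ideal.eq_top_of_isUnit_mem _ h hv₀u)
  have halg : algebraMap (R'.sectionsRing W) (R'.sectionsRing W) = RingHom.id _ := Algebra.algebraMap_self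
  -- the strict transform on the chart is the extension of `X(W)` (the saturation by the unit `t` is trivial)
  let J : Ideal (R'.sectionsRing W) := ⨆ m : ℕ, ((S.i.ker.ideal W).map
      (algebraMap Γ(S.Y, W) (R'.sectionsRing W))).colon
      ((Ideal.span {t} ^ m : Ideal (R'.sectionsRing W)) : Set (R'.sectionsRing W))
  have hJeq : J = (S.i.ker.ideal W).map (algebraMap Γ(S.Y, W) (R'.sectionsRing W)) := by
    have htop : ∀ m : ℕ, ((Ideal.span {t} ^ m : Ideal (R'.sectionsRing W)) : Set (R'.sectionsRing W)) = Set.univ :=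
      fun m => by rw [Ideal.span_singleton_eq_top.mpr htu, Ideal.top_pow]; rfl
    refine le_antisymm (iSup_le fun m => ?_) (le_iSup_of_le 0 ?_)
    · rw [htop m, Submodule.colon_univ]
    · rw [htop 0, Submodule.colon_univ]
  have hI'W' : (R'.strictTransformPlus S.i.ker).ideal W' = J.comap e.toRingHom := by
    rw [he₃ S.i.ker, halg, RingHom.id_comp]
    rfl
  -- (4) the primes: `P'` of `η'` on the chart, `Q` its transport to `⊕ 𝒥ₙ tⁿ`, `p` of `σ₊ η'` on `W`
  let P' := W'.2.primeIdealOf ⟨η', hη'W'⟩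
  obtain ⟨Q, hQdef⟩ : ∃ Q : Ideal (R'.sectionsRing W), Q = P'.asIdeal.map e.toRingHom := ⟨_, rfl⟩
  haveI hQ : Q.IsPrime := by rw [hQdef]; exact Ideal.map_isPrime_of_equiv e
  have hebij : Function.Bijective e.toRingHom := e.bijective
  have hQcomap : Q.comap e.toRingHom = P'.asIdeal := by
    rw [hQdef]
    exact Ideal.comap_map_of_bijective e.toRingHom hebij
  have htQ : t ∉ Q := fun h => hQ.ne_top (Ideal.eq_top_of_isUnit_mem _ h htu)
  let p := W.2.primeIdealOf ⟨R'.πPlus η', hyW'⟩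
  have halgW : ∀ s : Γ(S.Y, W), algebraMap Γ(S.Y, W) (R'.sectionsRing W) s = e (R'.πPlus.appLE W W' hW' s) :=
    fun s => by rw [he₁ s, halg, RingHom.id_apply]
  have hp : Q.comap (algebraMap Γ(S.Y, W) (R'.sectionsRing W)) = p.asIdeal := by
    have h1 : algebraMap Γ(S.Y, W) (R'.sectionsRing W) = e.toRingHom.comp (R'.πPlus.appLE W W' hW').hom :=
      RingHom.ext fun s => halgW s
    rw [h1, ← Ideal.comap_comap, hQcomap]
    exact congr($(IsAffineOpen.comap_primeIdealOf_appLE (f := R'.πPlus) (x := η') W W.2 W' W'.2 hW' hη'W').1)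
  -- (5) the stalk of `B₊` at `η'` is the localisation of `⊕ 𝒥ₙ(W) tⁿ` at `Q` (along `e`)
  letI algO' : Algebra Γ((R'.plus : Scheme.{0}), W') ((R'.plus : Scheme.{0}).presheaf.stalk η') :=
    (R'.plus : Scheme.{0}).presheaf.algebra_section_stalk (⟨η', hη'W'⟩ : ((W' : (R'.plus : Scheme.{0}).Opens)))
  haveI hlocO' : IsLocalization.AtPrime ((R'.plus : Scheme.{0}).presheaf.stalk η') P'.asIdeal :=
    W'.2.isLocalization_stalk ⟨η', hη'W'⟩
  have hloc₁ := IsLocalization.isLocalization_of_base_ringEquiv P'.asIdeal.primeCompl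
    ((R'.plus : Scheme.{0}).presheaf.stalk η') e
  letI algR : Algebra (R'.sectionsRing W) ((R'.plus : Scheme.{0}).presheaf.stalk η') :=
    ((algebraMap Γ((R'.plus : Scheme.{0}), W') ((R'.plus : Scheme.{0}).presheaf.stalk η')).comp
      e.symm.toRingHom).toAlgebra
  have halgR : ∀ z : R'.sectionsRing W, algebraMap (R'.sectionsRing W) ((R'.plus : Scheme.{0}).presheaf.stalk η') z =
      ((R'.plus : Scheme.{0}).presheaf.germ W' η' hη'W').hom (e.symm z) := fun _ => rfl
  haveI hloc₂ : IsLocalization.AtPrime ((R'.plus : Scheme.{0}).presheaf.stalk η') Q := by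
    unfold IsLocalization.AtPrime
    convert hloc₁ using 2
    ext w
    simp only [Submonoid.mem_map, Ideal.mem_primeCompl_iff]
    constructor
    · intro hw
      refine ⟨e.symm w, fun h => hw ?_, by simp⟩
      rw [← hQcomap, Ideal.mem_comap] at h
      simpa using h
    · rintro ⟨z, hz, rfl⟩
      intro hw
      apply hz
      rw [← hQcomap, Ideal.mem_comap]
      exact hw
  -- (6) the stalk of `Y` at `σ₊ η'` is the localisation of `Γ(Y, W)` at `p`; `σ₊^♯` lies over `Γ(Y, W) → ⊕ 𝒥ₙ(W) tⁿ`
  letI algO : Algebra Γ(S.Y, W) (S.Y.presheaf.stalk (R'.πPlus η')) :=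
    S.Y.presheaf.algebra_section_stalk (⟨R'.πPlus η', hyW'⟩ : (W : S.Y.Opens))
  haveI hlocO : IsLocalization.AtPrime (S.Y.presheaf.stalk (R'.πPlus η')) p.asIdeal :=
    W.2.isLocalization_stalk ⟨R'.πPlus η', hyW'⟩
  have halgO : ∀ a : Γ(S.Y, W), algebraMap Γ(S.Y, W) (S.Y.presheaf.stalk (R'.πPlus η')) a =
      (S.Y.presheaf.germ W (R'.πPlus η') hyW').hom a := fun _ => rfl
  have hℓ : ∀ a : Γ(S.Y, W), (R'.πPlus.stalkMap η').hom (algebraMap Γ(S.Y, W) (S.Y.presheaf.stalk (R'.πPlus η')) a) =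
      algebraMap (R'.sectionsRing W) ((R'.plus : Scheme.{0}).presheaf.stalk η')
        (algebraMap Γ(S.Y, W) (R'.sectionsRing W) a) := fun a => by
    rw [halgR, halgW a, RingEquiv.symm_apply_apply, halgO]
    exact (germ_appLE_apply R'.πPlus W W' hW' η' hη'W' a).symm
  -- (7) the ring-level model
  obtain ⟨𝔮, h𝔮, h𝔮m, e₂, he₂⟩ := TrivialEnd.exists_offCentre_polynomial_model (R'.filtration W) t ht Q htQ hp
    (S.Y.presheaf.stalk (R'.πPlus η')) ((R'.plus : Scheme.{0}).presheaf.stalk η') (R'.πPlus.stalkMap η').hom hℓ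
  -- (8) the local equations: `σˢ(X)_{η'} = X(W) · 𝒪_{B₊,η'} = σ₊^♯ (X_y) · 𝒪_{B₊,η'}`
  have hideal : stalkIdeal (R'.strictTransformPlus S.i.ker) η' =
      J.map (algebraMap (R'.sectionsRing W) ((R'.plus : Scheme.{0}).presheaf.stalk η')) := by
    rw [stalkIdeal_eq_map_germ (R'.strictTransformPlus S.i.ker) W' hη'W', hI'W']
    have hJe : J.comap e.toRingHom = J.map (e.symm : R'.sectionsRing W →+* _) := by
      rw [RingEquiv.toRingHom_eq_coe]
      exact (Ideal.map_symm e).symm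
    rw [hJe, Ideal.map_map]
    rfl
  have hmapX : (stalkIdeal S.i.ker (R'.πPlus η')).map (R'.πPlus.stalkMap η').hom =
      stalkIdeal (R'.strictTransformPlus S.i.ker) η' := by
    rw [hideal, hJeq, stalkIdeal_eq_map_germ S.i.ker W hyW', Ideal.map_map, Ideal.map_map]
    congr 1
    exact RingHom.ext fun a => hℓ a
  -- principal generators on both sides
  have hprY : ∃ g : S.Y.presheaf.stalk (R'.πPlus η'), stalkIdeal S.i.ker (R'.πPlus η') = Ideal.span {g} :=
    (S.isLocallyPrincipal (R'.πPlus η')).isPrincipal_stalkIdeal.principal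
  have hγ := stalkIdeal_eq_span_localGenerator S.i.ker (R'.πPlus η') hprY
  have hker : (R'.strictTransformPlus S.i.ker).subschemeι.ker = R'.strictTransformPlus S.i.ker :=
    Scheme.IdealSheafData.ker_subschemeι _
  have hprB : ∃ g : (R'.plus : Scheme.{0}).presheaf.stalk η',
      stalkIdeal (R'.strictTransformPlus S.i.ker).subschemeι.ker η' = Ideal.span {g} :=
    (hlp' η').isPrincipal_stalkIdeal.principal
  have hγ' : stalkIdeal (R'.strictTransformPlus S.i.ker) η' =
      Ideal.span {localGenerator (R'.strictTransformPlus S.i.ker).subschemeι.ker η'} :=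
    (congrArg (fun I => stalkIdeal I η') hker).symm.trans
      (stalkIdeal_eq_span_localGenerator (R'.strictTransformPlus S.i.ker).subschemeι.ker η' hprB)
  -- `𝒪_{B₊,η'}` is a domain (`B₊` is smooth over `k`)
  haveI : IsRegularLocalRing ((R'.plus : Scheme.{0}).presheaf.stalk η') :=
    isRegularLocalRing_stalk_of_smooth_of_field (R'.πPlus ≫ S.f) η'
  haveI : IsDomain ((R'.plus : Scheme.{0}).presheaf.stalk η') := isDomain_of_isRegularLocalRing _
  have hassoc : Associated ((R'.πPlus.stalkMap η').hom (localGenerator S.i.ker (R'.πPlus η')))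
      (localGenerator (R'.strictTransformPlus S.i.ker).subschemeι.ker η') := by
    rw [← Ideal.span_singleton_eq_span_singleton, ← hγ', ← hmapX, hγ, Ideal.map_span, Set.image_singleton]
  refine ⟨𝔮, h𝔮, h𝔮m, e₂, he₂, ?_⟩
  rw [he₂]
  exact hassoc

end Summit.ResolutionOfSingularities.ResolutionOfSingularities.Theorems.ELadderOne

/-! ## The registrar's `E2StepOffBody p`, binder for binder -/

namespace Summit.ResolutionOfSingularities.ResolutionOfSingularities.Cruxes.HypersurfaceCentreConstruction.LocalEngine

open CategoryTheory AlgebraicGeometry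
open Summit.ResolutionOfSingularities.ResolutionOfSingularities.Theorems
open Summit.ResolutionOfSingularities.ResolutionOfSingularities.Theorems.ELadderOne

/-- **(o59-a) `E2StepOffBody p` — the SPEC (Δ6) statement of res-L1-w43-plan-1, binder for binder** (the named `Prop` of
`HOME/L/res-L1-w43-plan-1/E2Step_split_sketch.lean` rev 3 is closed by this term; `p`, `CharP`, `PerfectField` are not used:
the off-support model is characteristic-free). Input `ha` of the registrar's glue `stub_e2_step_h_of_four'`.
[cite: Wlodarczyk2022, Def. 2.3.5 and 3.3.12] -/
theorem e2StepOffBody (p : ℕ) :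
    ∀ ⦃k : Type⦄ [Field k] [CharP k p] [PerfectField k] (S : Stage k)
      (R : ReesAlgebraData S.Y), IsAdmissibleCentre S.f S.i.ker R →
        ∀ (R' : ReesFiltration S.Y), R'.ideal = R.piece →
      ∀ [Smooth (R'.πPlus ≫ S.f)] [IsSeparated (R'.πPlus ≫ S.f)] [QuasiCompact (R'.πPlus ≫ S.f)]
        [IsIntegral (R'.strictTransformPlus S.i.ker).subscheme]
        (hlp' : IsLocallyPrincipal (R'.strictTransformPlus S.i.ker).subschemeι.ker)
        (V' : Scheme.{0}) (ρ : V' ⟶ S.V) [IsIntegral V'] [IsProper ρ]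
        (q' : (R'.strictTransformPlus S.i.ker).subscheme ⟶ V')
        (hq' : q' ≫ ρ ≫ S.g = (R'.strictTransformPlus S.i.ker).subschemeι ≫ R'.πPlus ≫ S.f)
        (𝒜' : GradedAtlas (S.j + 1) (R'.πPlus ≫ S.f) (R'.strictTransformPlus S.i.ker).subschemeι q'),
      ∀ η' : (R'.plus : Scheme.{0}), R'.πPlus.base η' ∉ R.support →
        S.SuccOffCentreAt ⟨R'.plus, R'.πPlus ≫ S.f, (R'.strictTransformPlus S.i.ker).subscheme,
            (R'.strictTransformPlus S.i.ker).subschemeι, hlp', V', q', ρ ≫ S.g, hq', S.j + 1, 𝒜'⟩ R'.πPlus η' :=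
  fun _ _ _ _ S R hadm R' hR' _ _ _ _ hlp' V' ρ _ _ q' hq' 𝒜' η' hη' =>
    succOffCentreAt_of_not_mem_support S R hadm R' hR' hlp' V' ρ q' hq' 𝒜' η' hη'

end Summit.ResolutionOfSingularities.ResolutionOfSingularities.Cruxes.HypersurfaceCentreConstruction.LocalEngine

end
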